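import Summits.QuantumFields.YangMills.Theorems.ColdStartUniversalityLatticeLangevinRiemannLipschitzContraction
import Summits.QuantumFields.YangMills.Theorems.ColdStartUniversalityShenZhuZhuRiemannDistTriangleSU2
import Mathlib.Analysis.Calculus.MeanValue
import HarnessLib

/-!
# `ρ_L` IS A GEODESIC METRIC: the product one-parameter flow `s ↦ (e^(sX_e) Q_e)_e` along minimal logarithms is a constant-speed minimal geodesic,
# and a LOCAL Lipschitz bound for `ρ_L` globalises along it (`Lip = sup of local dilatations`)

Seat `ym-line-csu-p1` (g41), route `ColdStartUniversality` of `Summits/QuantumFields/YangMills`, helper file G51 (`--supports stmt-QuantumFields-24809`).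
Second brick of the all-Lipschitz extension of the `ρ_L`-contraction (G44): to control the `ρ_L`-Lipschitz constant of a mollified function on
`SU(2)^E` it suffices to control its LOCAL dilatation, because Shen–Zhu–Zhu's product Riemannian distance is realised by explicit constant-speed paths.

* ★ `riemannDist_expSU_mul_two` — `ρ(e^(sX)q, e^(s'X)q) = |s − s'|·|X|` for `X ∈ 𝔰𝔲(2)`, `|s − s'|·|X| ≤ √2·π` (right-invariance + G40's closed form);
* ★ `sqrt_torusRiemannDistSq_prodFlow_eq` — along the product flow of the minimal logarithms, `ρ_L(γ_s, γ_(s')) = |s − s'|·ρ_L(Q,Q')` for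
  `s, s' ∈ [0,1]`: `γ` is a minimal geodesic of the metric space `(SU(2)^E, ρ_L)` parametrised proportionally to arc length;
* `abs_sub_le_of_local_lipschitz_Icc` — a real-variable lemma: a function on `[0,1]` that is locally `K`-Lipschitz at every point satisfies
  `|φ(1) − φ(0)| ≤ K` (continuous induction, `image_le_of_liminf_slope_right_le_deriv_boundary`);
* ★★★ `riemannLipschitz_of_local` — **if `h : SU(2)^E → ℝ` has local `ρ_L`-dilatation `≤ C` at every point** (for every `Q₀` and `η > 0` there is
  `δ > 0` with `|h Q' − h Q| ≤ (C+η)·ρ_L(Q,Q')` whenever `ρ_L(Q₀,Q), ρ_L(Q₀,Q') < δ`) **then `h` is globally `C`-Lipschitz for `ρ_L`.**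

THEOREMS ONLY, no definition, no sorry.  HONEST FRAMING: metric geometry of `SU(2)^E`; nothing about the dynamics or the route's scaling;
`UniformColdStartMixing` (24809, ASIDE) not restated; no crux, rung or summit statement is proved; the Yang–Mills mass gap is NOT proved.

References: S. Gallot, D. Hulin, J. Lafontaine, *Riemannian Geometry* (2004), 2.90–2.91 (geodesics of bi-invariant metrics, the Riemannian
distance is a length metric) [GallotHulinLafontaine2004]; H. Shen, R. Zhu, X. Zhu, CMP 400 (2023), §4.1 [ShenZhuZhu2022].
-/

set_option autoImplicit false

noncomputable section

namespace Summit.QuantumFields.YangMills.Theorems.ColdStartUniversality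

open MeasureTheory Matrix Complex Finset Filter Topology Set
open scoped ComplexConjugate BigOperators Real NNReal
open Literature.MathematicalPhysics.QuantumFieldTheory
open Literature.MathematicalPhysics.QuantumLattice (fundamentalRep fundamentalLatticeRep continuous_fundamentalRep fundamentalRep_apply fundamentalLatticeRep_N)

/-! ## §1. One link: `ρ(e^(sX)q, e^(s'X)q) = |s − s'|·|X|` -/

/-- ★ **Constant speed along one-parameter subgroups**: for `X ∈ 𝔰𝔲(2)`, `q ∈ SU(2)` and `|s − s'|·|X| ≤ √2·π`:
`ρ(e^(sX) q, e^(s'X) q) = |s − s'|·|X|` (`|X|² = Re tr(XXᴴ)`). [cite: GallotHulinLafontaine2004, 2.90] -/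
theorem riemannDist_expSU_mul_two {X : Matrix (Fin 2) (Fin 2) ℂ}
    (hXmem : X ∈ (fundamentalLatticeRep 2).lieAlg) (hXh : Xᴴ = -X) (hX0 : X.trace = 0) (q : Matrix.specialUnitaryGroup (Fin 2) ℂ)
    {s s' : ℝ} (hss : |s - s'| * Real.sqrt (hsForm 2 X X) ≤ Real.sqrt 2 * Real.pi) :
    (fundamentalLatticeRep 2).riemannDist
        (SUNBakryEmery.expSU (N := 2) (Y := Matrix.of fun i j : Fin 2 => X i j) hXh hX0 s * q)
        (SUNBakryEmery.expSU (N := 2) (Y := Matrix.of fun i j : Fin 2 => X i j) hXh hX0 s' * q) =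
      |s - s'| * Real.sqrt (hsForm 2 X X) := by
  rw [riemannDist_two_mul_right, riemannDist_two_eq]
  -- the relative position is `e^((s'−s)X)`
  have hstar : star ((SUNBakryEmery.expSU (N := 2) (Y := Matrix.of fun i j : Fin 2 => X i j) hXh hX0 s : Matrix.specialUnitaryGroup (Fin 2) ℂ) :
      Matrix (Fin 2) (Fin 2) ℂ) = NormedSpace.exp (-(s • X)) := by
    change star (NormedSpace.exp (s • X)) = _
    rw [Matrix.star_eq_conjTranspose, ← Matrix.exp_conjTranspose, Matrix.conjTranspose_smul, hXh, star_trivial, smul_neg]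
  have hprod : ((SUNBakryEmery.expSU (N := 2) (Y := Matrix.of fun i j : Fin 2 => X i j) hXh hX0 s' : Matrix.specialUnitaryGroup (Fin 2) ℂ) :
      Matrix (Fin 2) (Fin 2) ℂ) * star ((SUNBakryEmery.expSU (N := 2) (Y := Matrix.of fun i j : Fin 2 => X i j) hXh hX0 s :
        Matrix.specialUnitaryGroup (Fin 2) ℂ) : Matrix (Fin 2) (Fin 2) ℂ) = NormedSpace.exp ((s' - s) • X) := by
    rw [hstar]
    change NormedSpace.exp (s' • X) * NormedSpace.exp (-(s • X)) = _
    rw [← Matrix.exp_add_of_commute (s' • X) (-(s • X)) (((Commute.refl X).smul_left s').smul_right s |>.neg_right), sub_smul,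
      sub_eq_add_neg]
  rw [hprod]
  have hmem : ((s' - s) • X) ∈ (fundamentalLatticeRep 2).lieAlg := (fundamentalLatticeRep 2).lieAlg.smul_mem _ hXmem
  have htr : (NormedSpace.exp ((s' - s) • X)).trace.re = 2 * Real.cos (Real.sqrt (hsForm 2 ((s' - s) • X) ((s' - s) • X) / 2)) :=
    re_trace_exp_of_mem_lieAlg_two hmem
  have hθ : Real.sqrt (hsForm 2 ((s' - s) • X) ((s' - s) • X) / 2) = |s - s'| * Real.sqrt (hsForm 2 X X / 2) := by
    have e : hsForm 2 ((s' - s) • X) ((s' - s) • X) = (s - s') ^ 2 * hsForm 2 X X := by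
      rw [hsForm_real_smul_left, hsForm_comm, hsForm_real_smul_left]; ring
    rw [e, mul_div_assoc, Real.sqrt_mul (sq_nonneg _), Real.sqrt_sq_eq_abs]
  rw [htr, hθ, show 2 * Real.cos (|s - s'| * Real.sqrt (hsForm 2 X X / 2)) / 2 =
    Real.cos (|s - s'| * Real.sqrt (hsForm 2 X X / 2)) by ring]
  have h2 : (0 : ℝ) < Real.sqrt 2 := Real.sqrt_pos.2 (by norm_num)
  have hhalf : Real.sqrt (hsForm 2 X X / 2) = Real.sqrt (hsForm 2 X X) / Real.sqrt 2 := by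
    rw [Real.sqrt_div (hsForm_self_nonneg _)]
  have hnonneg : 0 ≤ |s - s'| * Real.sqrt (hsForm 2 X X / 2) := by positivity
  have hle : |s - s'| * Real.sqrt (hsForm 2 X X / 2) ≤ Real.pi := by
    rw [hhalf, ← mul_div_assoc, div_le_iff₀ h2, mul_comm Real.pi]; exact hss
  rw [Real.arccos_cos hnonneg hle, hhalf]
  field_simp

/-! ## §2. The product flow of the minimal logarithms is a constant-speed geodesic of `ρ_L` -/

/-- ★ **`ρ_L(γ_s, γ_(s')) = |s − s'|·√(Σ_e |X_e|²)`** along the product flow `(γ_s)_e = e^(sX_e) Q_e`, for `X_e ∈ 𝔰𝔲(2)` with `|X_e| ≤ √2π` and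
`s, s' ∈ [0,1]`; with the minimal logarithms (`Σ_e|X_e|² = ρ_L(Q,Q')²`, G40) this says `ρ_L(γ_s,γ_(s')) = |s − s'|·ρ_L(Q,Q')`. [cite: ShenZhuZhu2022, §4.1] -/
theorem sqrt_torusRiemannDistSq_prodFlow_eq {L : ℕ} [NeZero L] (Q : GaugeConfig 3 L (Matrix.specialUnitaryGroup (Fin 2) ℂ))
    (X : Edge 3 L → Matrix (Fin 2) (Fin 2) ℂ) (hXmem : ∀ e, X e ∈ (fundamentalLatticeRep 2).lieAlg)
    (hXh : ∀ e, (X e)ᴴ = -(X e)) (hX0 : ∀ e, (X e).trace = 0) (hXle : ∀ e, Real.sqrt (hsForm 2 (X e) (X e)) ≤ Real.sqrt 2 * Real.pi)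
    {s s' : ℝ} (hs : s ∈ Icc (0 : ℝ) 1) (hs' : s' ∈ Icc (0 : ℝ) 1) :
    Real.sqrt (torusRiemannDistSq (fundamentalLatticeRep 2)
        (fun e => SUNBakryEmery.expSU (N := 2) (Y := Matrix.of fun i j : Fin 2 => X e i j) (hXh e) (hX0 e) s * Q e)
        (fun e => SUNBakryEmery.expSU (N := 2) (Y := Matrix.of fun i j : Fin 2 => X e i j) (hXh e) (hX0 e) s' * Q e)) =
      |s - s'| * Real.sqrt (∑ e : Edge 3 L, hsForm 2 (X e) (X e)) := by
  have hss : |s - s'| ≤ 1 := by rw [abs_le]; constructor <;> linarith [hs.1, hs.2, hs'.1, hs'.2]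
  unfold torusRiemannDistSq
  have hterm : ∀ e : Edge 3 L, (fundamentalLatticeRep 2).riemannDist
        (SUNBakryEmery.expSU (N := 2) (Y := Matrix.of fun i j : Fin 2 => X e i j) (hXh e) (hX0 e) s * Q e)
        (SUNBakryEmery.expSU (N := 2) (Y := Matrix.of fun i j : Fin 2 => X e i j) (hXh e) (hX0 e) s' * Q e) ^ 2 =
      (s - s') ^ 2 * hsForm 2 (X e) (X e) := by
    intro e
    have hle : |s - s'| * Real.sqrt (hsForm 2 (X e) (X e)) ≤ Real.sqrt 2 * Real.pi :=
      le_trans (mul_le_of_le_one_left (Real.sqrt_nonneg _) hss) (hXle e)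
    rw [riemannDist_expSU_mul_two (hXmem e) (hXh e) (hX0 e) (Q e) hle, mul_pow, sq_abs, Real.sq_sqrt (hsForm_self_nonneg _)]
  simp_rw [hterm]
  rw [← Finset.mul_sum, Real.sqrt_mul (sq_nonneg _), Real.sqrt_sq_eq_abs]

/-! ## §3. A real-variable lemma: local Lipschitz bounds on `[0,1]` globalise -/

/-- If `φ : ℝ → ℝ` is locally `K`-Lipschitz at every point of `[0,1]` (relative to `[0,1]`), then `φ 1 ≤ φ 0 + K`. [folklore] -/
theorem sub_le_of_local_lipschitz_Icc (φ : ℝ → ℝ) {K : ℝ} (hK : 0 ≤ K)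
    (hloc : ∀ s ∈ Icc (0 : ℝ) 1, ∃ δ > 0, ∀ s' ∈ Icc (0 : ℝ) 1, ∀ s'' ∈ Icc (0 : ℝ) 1, |s' - s| < δ → |s'' - s| < δ →
      |φ s' - φ s''| ≤ K * |s' - s''|) :
    φ 1 ≤ φ 0 + K := by
  -- continuity on `[0,1]`
  have hcont : ContinuousOn φ (Icc (0 : ℝ) 1) := by
    intro s hs
    obtain ⟨δ, hδ, h⟩ := hloc s hs
    rw [Metric.continuousWithinAt_iff]
    intro ε hε
    refine ⟨min δ (ε / (K + 1)), lt_min hδ (by positivity), fun s' hs' hd => ?_⟩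
    rw [Real.dist_eq] at hd ⊢
    have hd1 : |s' - s| < δ := lt_of_lt_of_le hd (min_le_left _ _)
    have hd2 : |s' - s| < ε / (K + 1) := lt_of_lt_of_le hd (min_le_right _ _)
    have hb := h s' hs' s hs hd1 (by simp [hδ])
    calc |φ s' - φ s| ≤ K * |s' - s| := hb
      _ ≤ (K + 1) * |s' - s| := mul_le_mul_of_nonneg_right (by linarith) (abs_nonneg _)
      _ < (K + 1) * (ε / (K + 1)) := mul_lt_mul_of_pos_left hd2 (by linarith)
      _ = ε := by field_simp
  have key := image_le_of_liminf_slope_right_le_deriv_boundary (f := φ) (a := 0) (b := 1) hcont (B := fun x => φ 0 + K * x)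
    (B' := fun _ => K) (by simp) (by fun_prop) (fun x _ => by
      have h := ((hasDerivAt_id x).const_mul K).const_add (φ 0)
      simpa using h.hasDerivWithinAt) ?_
  · have h1 := key (show (1 : ℝ) ∈ Icc (0 : ℝ) 1 by simp)
    simpa using h1
  · intro x hx r hr
    obtain ⟨δ, hδ, h⟩ := hloc x (Ico_subset_Icc_self hx)
    refine Filter.Eventually.frequently ?_
    rw [eventually_nhdsWithin_iff, Metric.eventually_nhds_iff]
    refine ⟨min δ (1 - x), lt_min hδ (by linarith [hx.2]), fun z hz hzx => ?_⟩
    rw [Real.dist_eq] at hz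
    have hz1 : |z - x| < δ := lt_of_lt_of_le hz (min_le_left _ _)
    have hz2 : |z - x| < 1 - x := lt_of_lt_of_le hz (min_le_right _ _)
    have hzx' : x < z := hzx
    have hzI : z ∈ Icc (0 : ℝ) 1 := by
      rw [abs_of_pos (sub_pos.2 hzx')] at hz2
      exact ⟨by linarith [hx.1], by linarith⟩
    have hb := h z hzI x (Ico_subset_Icc_self hx) hz1 (by simp [hδ])
    rw [slope_def_field]
    rw [abs_of_pos (sub_pos.2 hzx')] at hb
    calc (φ z - φ x) / (z - x) ≤ K * (z - x) / (z - x) := div_le_div_of_nonneg_right ((le_abs_self _).trans hb) (sub_pos.2 hzx').le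
      _ = K := mul_div_cancel_right₀ K (sub_pos.2 hzx').ne'
      _ < r := hr

/-- The two-sided form: `|φ 1 − φ 0| ≤ K`. [folklore] -/
theorem abs_sub_le_of_local_lipschitz_Icc (φ : ℝ → ℝ) {K : ℝ} (hK : 0 ≤ K)
    (hloc : ∀ s ∈ Icc (0 : ℝ) 1, ∃ δ > 0, ∀ s' ∈ Icc (0 : ℝ) 1, ∀ s'' ∈ Icc (0 : ℝ) 1, |s' - s| < δ → |s'' - s| < δ →
      |φ s' - φ s''| ≤ K * |s' - s''|) :
    |φ 1 - φ 0| ≤ K := by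
  have h1 := sub_le_of_local_lipschitz_Icc φ hK hloc
  have h2 := sub_le_of_local_lipschitz_Icc (fun s => -φ s) hK (fun s hs => by
    obtain ⟨δ, hδ, h⟩ := hloc s hs
    exact ⟨δ, hδ, fun s' hs' s'' hs'' h1 h2 => by rw [show -φ s' - -φ s'' = -(φ s' - φ s'') by ring, abs_neg]; exact h s' hs' s'' hs'' h1 h2⟩)
  rw [abs_le]; constructor <;> linarith

/-! ## §4. Local-to-global for `ρ_L`-Lipschitz bounds on `SU(2)^E` -/

/-- ★★★ **Local `ρ_L`-dilatation `≤ C` everywhere ⇒ globally `C`-Lipschitz for `ρ_L`.**  Let `h : SU(2)^E → ℝ` and `C ≥ 0` be such that for every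
`Q₀` and every `η > 0` there is `δ > 0` with `|h Q' − h Q| ≤ (C + η)·ρ_L(Q,Q')` whenever `ρ_L(Q₀,Q) < δ` and `ρ_L(Q₀,Q') < δ`.  Then
`|h Q' − h Q| ≤ C·ρ_L(Q,Q')` for ALL `Q, Q'` (`ρ_L = √torusRiemannDistSq` is a geodesic metric: test along the constant-speed product flow of the
minimal logarithms). [cite: GallotHulinLafontaine2004, 2.91] -/
theorem riemannLipschitz_of_local {L : ℕ} [NeZero L] {h : GaugeConfig 3 L (Matrix.specialUnitaryGroup (Fin 2) ℂ) → ℝ} {C : ℝ} (hC : 0 ≤ C)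
    (hloc : ∀ (Q₀ : GaugeConfig 3 L (Matrix.specialUnitaryGroup (Fin 2) ℂ)) (η : ℝ), 0 < η → ∃ δ > 0,
      ∀ Q Q' : GaugeConfig 3 L (Matrix.specialUnitaryGroup (Fin 2) ℂ),
        Real.sqrt (torusRiemannDistSq (fundamentalLatticeRep 2) Q₀ Q) < δ → Real.sqrt (torusRiemannDistSq (fundamentalLatticeRep 2) Q₀ Q') < δ →
          |h Q' - h Q| ≤ (C + η) * Real.sqrt (torusRiemannDistSq (fundamentalLatticeRep 2) Q Q'))
    (Q Q' : GaugeConfig 3 L (Matrix.specialUnitaryGroup (Fin 2) ℂ)) :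
    |h Q' - h Q| ≤ C * Real.sqrt (torusRiemannDistSq (fundamentalLatticeRep 2) Q Q') := by
  classical
  -- minimal logarithms and the product flow
  have hlog : ∀ e : Edge 3 L, ∃ X : Matrix (Fin 2) (Fin 2) ℂ, X ∈ (fundamentalLatticeRep 2).lieAlg ∧
      NormedSpace.exp X * (Q e : Matrix (Fin 2) (Fin 2) ℂ) = (Q' e : Matrix (Fin 2) (Fin 2) ℂ) ∧
      Real.sqrt (hsForm 2 X X) = (fundamentalLatticeRep 2).riemannDist (Q e) (Q' e) := fun e =>
    exists_mem_lieAlg_exp_mul_eq_sqrt_hsForm_eq_riemannDist (Q e) (Q' e)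
  choose X hXmem hXexp hXnorm using hlog
  have hXh : ∀ e, (X e)ᴴ = -(X e) := fun e => by
    rw [← Matrix.star_eq_conjTranspose]; exact (fundamentalLatticeRep 2).star_eq_neg_of_mem_lieAlg (hXmem e)
  have hX0 : ∀ e, (X e).trace = 0 := fun e => trace_eq_zero_of_mem_lieAlg_two (hXmem e)
  have hXle : ∀ e, Real.sqrt (hsForm 2 (X e) (X e)) ≤ Real.sqrt 2 * Real.pi := fun e => by
    rw [hXnorm e]; exact riemannDist_two_le _ _
  set D : ℝ := Real.sqrt (torusRiemannDistSq (fundamentalLatticeRep 2) Q Q') with hD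
  have hD0 : 0 ≤ D := Real.sqrt_nonneg _
  have hDX : Real.sqrt (∑ e : Edge 3 L, hsForm 2 (X e) (X e)) = D := by
    rw [hD]; unfold torusRiemannDistSq; congr 1
    exact Finset.sum_congr rfl fun e _ => by rw [← hXnorm e, Real.sq_sqrt (hsForm_self_nonneg _)]
  set γ : ℝ → GaugeConfig 3 L (Matrix.specialUnitaryGroup (Fin 2) ℂ) := fun s e =>
    SUNBakryEmery.expSU (N := 2) (Y := Matrix.of fun i j : Fin 2 => X e i j) (hXh e) (hX0 e) s * Q e with hγ
  have hγ0 : γ 0 = Q := by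
    funext e; apply Subtype.ext
    change NormedSpace.exp ((0 : ℝ) • X e) * (Q e : Matrix (Fin 2) (Fin 2) ℂ) = (Q e : Matrix (Fin 2) (Fin 2) ℂ)
    rw [zero_smul, NormedSpace.exp_zero, Matrix.one_mul]
  have hγ1 : γ 1 = Q' := by
    funext e; apply Subtype.ext
    change NormedSpace.exp ((1 : ℝ) • X e) * (Q e : Matrix (Fin 2) (Fin 2) ℂ) = (Q' e : Matrix (Fin 2) (Fin 2) ℂ)
    rw [one_smul, hXexp e]
  have hdist : ∀ s ∈ Icc (0 : ℝ) 1, ∀ s' ∈ Icc (0 : ℝ) 1, Real.sqrt (torusRiemannDistSq (fundamentalLatticeRep 2) (γ s) (γ s')) = |s - s'| * D := by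
    intro s hs s' hs'
    rw [← hDX]; exact sqrt_torusRiemannDistSq_prodFlow_eq Q X hXmem hXh hX0 hXle hs hs'
  -- the function along the flow is locally `(C+η)D`-Lipschitz on `[0,1]`
  set φ : ℝ → ℝ := fun s => h (γ s) with hφ
  have hmain : ∀ η : ℝ, 0 < η → |φ 1 - φ 0| ≤ (C + η) * D := by
    intro η hη
    refine abs_sub_le_of_local_lipschitz_Icc φ (by positivity) fun s hs => ?_
    obtain ⟨δ, hδ, hδb⟩ := hloc (γ s) η hη
    refine ⟨δ / (D + 1), by positivity, fun s' hs' s'' hs'' h1 h2 => ?_⟩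
    have hD1 : 0 < D + 1 := by linarith
    have hclose : ∀ t ∈ Icc (0 : ℝ) 1, |t - s| < δ / (D + 1) → Real.sqrt (torusRiemannDistSq (fundamentalLatticeRep 2) (γ s) (γ t)) < δ := by
      intro t ht hts
      rw [hdist s hs t ht, abs_sub_comm]
      calc |t - s| * D ≤ |t - s| * (D + 1) := mul_le_mul_of_nonneg_left (by linarith) (abs_nonneg _)
        _ < δ / (D + 1) * (D + 1) := mul_lt_mul_of_pos_right hts hD1
        _ = δ := div_mul_cancel₀ _ hD1.ne'
    have hb := hδb (γ s'') (γ s') (hclose s'' hs'' h2) (hclose s' hs' h1)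
    rw [hdist s'' hs'' s' hs', abs_sub_comm s'' s'] at hb
    simp only [hφ]
    calc |h (γ s') - h (γ s'')| ≤ (C + η) * (|s' - s''| * D) := hb
      _ = (C + η) * D * |s' - s''| := by ring
  rw [show h Q' - h Q = φ 1 - φ 0 by simp only [hφ, hγ0, hγ1]]
  refine le_of_forall_pos_le_add fun ε hε => ?_
  by_cases hDz : D = 0
  · have h1 := hmain 1 one_pos
    rw [hDz, mul_zero] at h1
    rw [hDz, mul_zero, zero_add]; exact h1.trans hε.le
  · have hDpos : 0 < D := lt_of_le_of_ne hD0 (Ne.symm hDz)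
    have h1 := hmain (ε / D) (by positivity)
    calc |φ 1 - φ 0| ≤ (C + ε / D) * D := h1
      _ = C * D + ε := by field_simp

end Summit.QuantumFields.YangMills.Theorems.ColdStartUniversality

end
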